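import Literature.MathematicalPhysics.QuantumLattice.LTQOFrustrationFreeProofs
import Mathlib.Algebra.BigOperators.Fin
import HarnessLib

/-!
# The shell decomposition along a nested chain of projections

Twenty-first file of the formalisation of the Michalakis–Zwolak stability theorem (hubbard.S19):
the algebraic core of MZ13 §6 Lemma 4 (after Bravyi–Hastings–Michalakis, JMP **51** (2010)
093512, §7): for a nested chain of Hermitian projections `Q₀ ≥ Q₁ ≥ ⋯ ≥ Q_M`
(`Q_j Q_k = Q_j = Q_k Q_j` for `k ≤ j`; in the application `Q_k = P_{b_u(r₀+k)}`, the local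
ground-state projectors of growing balls, nested by frustration-freeness, with `Q_M = P₀`) the
shells `E₀ = 1 − Q₀`, `E_{k+1} = Q_k − Q_{k+1}` form an "orthogonal unity decomposition"
(MZ13 p. 13): `Σ_{k ≤ M} E_k = 1 − Q_M` (`sum_shells`), each `E_k` is a Hermitian projection of
norm `≤ 1`, and

* `compress_eq_sum_shells`: `(1 − Q_M) Y (1 − Q_M) = Σ_{p,r ≤ M} E_p Y E_r`;
* `proj_mul_doubleShell_eq_zero`, `doubleShell_mul_proj_eq_zero`: `Q_j (E_p Y E_r) = 0` for
  `p ≤ j` and `(E_p Y E_r) Q_j = 0` for `r ≤ j` — the double shells are annihilated on both sides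
  by the local ground-state projector of the ball of radius `max p r` (the property
  `W_u(r) P_{b_u(r)} = 0` required by the relative bound, `LTQORelativeBoundProofs`);
* `norm_doubleShell_le`, `norm_doubleShell_le'`, `norm_shell_mul_le`: the norms of the double
  shells are controlled by `‖Q_{p−1} Y‖ + ‖Q_p Y‖` (to be estimated by local
  indistinguishability, MZ13 Corollary 1).

No definitions, no named facts (theorems only). [folklore]
-/

noncomputable section

open Matrix Finset
open scoped Matrix Matrix.Norms.L2Operator

namespace Literature.MathematicalPhysics.QuantumLattice

variable {n : Type*} [Fintype n] [DecidableEq n]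

/-! ### The shells `E₀ = 1 − Q₀`, `E_{k+1} = Q_k − Q_{k+1}` of a nested chain `Q₀ ≥ Q₁ ≥ ⋯` -/

section Shells

variable (Q : ℕ → Matrix n n ℂ)

omit [Fintype n] in
/-- The telescoping sum of the shells: `Σ_{k ≤ M} E_k = 1 − Q_M`, where `E₀ = 1 − Q₀`,
`E_{k+1} = Q_k − Q_{k+1}`. MZ13 §6 proof of Lemma 4 ("orthogonal unity decomposition
`𝟙 = Σ_m E_m`", after Bravyi–Hastings–Michalakis 2010). [folklore] -/
theorem sum_shells (M : ℕ) :
    ∑ k ∈ range (M + 1), (if k = 0 then 1 - Q 0 else Q (k - 1) - Q k) = 1 - Q M := by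
  induction M with
  | zero => simp
  | succ M ih =>
    rw [sum_range_succ, ih, if_neg (Nat.succ_ne_zero M), Nat.succ_sub_one]
    abel

variable {Q}

/-- A nested chain of Hermitian projections: `Q_j Q_k = Q_j = Q_k Q_j` for `k ≤ j`. The shells
are annihilated by the deeper projections: `Q_j E_k = 0` for `k ≤ j`. [folklore] -/
theorem proj_mul_shell_eq_zero (hQ : ∀ k j, k ≤ j → Q j * Q k = Q j) {k j : ℕ} (hkj : k ≤ j) :
    Q j * (if k = 0 then 1 - Q 0 else Q (k - 1) - Q k) = 0 := by
  by_cases hk : k = 0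
  · subst hk
    rw [if_pos rfl, Matrix.mul_sub, Matrix.mul_one, hQ 0 j hkj, sub_self]
  · rw [if_neg hk, Matrix.mul_sub, hQ (k - 1) j (by omega), hQ k j hkj, sub_self]

/-- Symmetrically, `E_k Q_j = 0` for `k ≤ j`. [folklore] -/
theorem shell_mul_proj_eq_zero (hQ' : ∀ k j, k ≤ j → Q k * Q j = Q j) {k j : ℕ} (hkj : k ≤ j) :
    (if k = 0 then 1 - Q 0 else Q (k - 1) - Q k) * Q j = 0 := by
  by_cases hk : k = 0
  · subst hk
    rw [if_pos rfl, Matrix.sub_mul, Matrix.one_mul, hQ' 0 j hkj, sub_self]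
  · rw [if_neg hk, Matrix.sub_mul, hQ' (k - 1) j (by omega), hQ' k j hkj, sub_self]

/-- The shells are idempotent. [folklore] -/
theorem shell_mul_shell (hQ : ∀ k j, k ≤ j → Q j * Q k = Q j) (hQ' : ∀ k j, k ≤ j → Q k * Q j = Q j)
    (k : ℕ) :
    (if k = 0 then 1 - Q 0 else Q (k - 1) - Q k) * (if k = 0 then 1 - Q 0 else Q (k - 1) - Q k) =
      (if k = 0 then 1 - Q 0 else Q (k - 1) - Q k) := by
  by_cases hk : k = 0
  · subst hk
    rw [if_pos rfl, Matrix.sub_mul, Matrix.one_mul, Matrix.mul_sub, Matrix.mul_one, hQ 0 0 le_rfl]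
    abel
  · rw [if_neg hk]
    rw [Matrix.sub_mul, Matrix.mul_sub, Matrix.mul_sub, hQ (k - 1) (k - 1) le_rfl,
      hQ' (k - 1) k (by omega), hQ (k - 1) k (by omega), hQ k k le_rfl]
    abel

omit [Fintype n] in
/-- The shells are Hermitian when the `Q_k` are. [folklore] -/
theorem shell_isHermitian (hQh : ∀ k, (Q k).IsHermitian) (k : ℕ) :
    (if k = 0 then 1 - Q 0 else Q (k - 1) - Q k).IsHermitian := by
  by_cases hk : k = 0
  · rw [if_pos hk]; exact isHermitian_one.sub (hQh 0)
  · rw [if_neg hk]; exact (hQh _).sub (hQh _)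

/-- The shells have norm `≤ 1`. [folklore] -/
theorem norm_shell_le_one (hQ : ∀ k j, k ≤ j → Q j * Q k = Q j)
    (hQ' : ∀ k j, k ≤ j → Q k * Q j = Q j) (hQh : ∀ k, (Q k).IsHermitian) (k : ℕ) :
    ‖(if k = 0 then 1 - Q 0 else Q (k - 1) - Q k)‖ ≤ 1 :=
  norm_le_one_of_isHermitian_of_isIdempotentElem (shell_isHermitian hQh k) (shell_mul_shell hQ hQ' k)

/-- **The double shell decomposition** (MZ13 proof of Lemma 4):
`(1 − Q_M) Y (1 − Q_M) = Σ_{p,r ≤ M} E_p Y E_r`. [folklore] -/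
theorem compress_eq_sum_shells (M : ℕ) (Y : Matrix n n ℂ) :
    (1 - Q M) * Y * (1 - Q M) = ∑ p ∈ range (M + 1), ∑ r ∈ range (M + 1),
      (if p = 0 then 1 - Q 0 else Q (p - 1) - Q p) * Y * (if r = 0 then 1 - Q 0 else Q (r - 1) - Q r) := by
  rw [← sum_shells Q M, Finset.sum_mul, Finset.sum_mul]
  refine sum_congr rfl fun p _ => ?_
  rw [Finset.mul_sum]

/-- **Two-sided annihilation of the double shells** by the deeper projections:
`Q_j (E_p Y E_r) = 0 = (E_p Y E_r) Q_j` whenever `max p r ≤ j`. This is the property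
`W_u(r) P_{b_u(r)} = 0` of MZ13 Lemma 4 / Proposition 1. [folklore] -/
theorem proj_mul_doubleShell_eq_zero (hQ : ∀ k j, k ≤ j → Q j * Q k = Q j)
    {p r j : ℕ} (hp : p ≤ j) (Y : Matrix n n ℂ) :
    Q j * ((if p = 0 then 1 - Q 0 else Q (p - 1) - Q p) * Y *
      (if r = 0 then 1 - Q 0 else Q (r - 1) - Q r)) = 0 := by
  rw [← Matrix.mul_assoc, ← Matrix.mul_assoc, proj_mul_shell_eq_zero hQ hp, Matrix.zero_mul,
    Matrix.zero_mul]

/-- `(E_p Y E_r) Q_j = 0` for `r ≤ j`. [folklore] -/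
theorem doubleShell_mul_proj_eq_zero (hQ' : ∀ k j, k ≤ j → Q k * Q j = Q j) {p r j : ℕ}
    (hr : r ≤ j) (Y : Matrix n n ℂ) :
    ((if p = 0 then 1 - Q 0 else Q (p - 1) - Q p) * Y *
      (if r = 0 then 1 - Q 0 else Q (r - 1) - Q r)) * Q j = 0 := by
  rw [Matrix.mul_assoc, shell_mul_proj_eq_zero hQ' hr, Matrix.mul_zero]

/-- **Norm of a double shell**: `‖E_p Y E_r‖ ≤ ‖E_p Y‖` and, for `p ≥ 1`,
`‖E_p Y‖ ≤ ‖Q_{p−1} Y‖ + ‖Q_p Y‖`. [folklore] -/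
theorem norm_doubleShell_le (hQ : ∀ k j, k ≤ j → Q j * Q k = Q j)
    (hQ' : ∀ k j, k ≤ j → Q k * Q j = Q j) (hQh : ∀ k, (Q k).IsHermitian) (p r : ℕ)
    (Y : Matrix n n ℂ) :
    ‖(if p = 0 then 1 - Q 0 else Q (p - 1) - Q p) * Y *
      (if r = 0 then 1 - Q 0 else Q (r - 1) - Q r)‖ ≤
      ‖(if p = 0 then 1 - Q 0 else Q (p - 1) - Q p) * Y‖ := by
  calc _ ≤ ‖(if p = 0 then 1 - Q 0 else Q (p - 1) - Q p) * Y‖ *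
        ‖(if r = 0 then 1 - Q 0 else Q (r - 1) - Q r)‖ := norm_mul_le _ _
    _ ≤ ‖(if p = 0 then 1 - Q 0 else Q (p - 1) - Q p) * Y‖ * 1 :=
        mul_le_mul_of_nonneg_left (norm_shell_le_one hQ hQ' hQh r) (norm_nonneg _)
    _ = _ := mul_one _

/-- `‖E_p Y E_r‖ ≤ ‖Y E_r‖`. [folklore] -/
theorem norm_doubleShell_le' (hQ : ∀ k j, k ≤ j → Q j * Q k = Q j)
    (hQ' : ∀ k j, k ≤ j → Q k * Q j = Q j) (hQh : ∀ k, (Q k).IsHermitian) (p r : ℕ)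
    (Y : Matrix n n ℂ) :
    ‖(if p = 0 then 1 - Q 0 else Q (p - 1) - Q p) * Y *
      (if r = 0 then 1 - Q 0 else Q (r - 1) - Q r)‖ ≤
      ‖Y * (if r = 0 then 1 - Q 0 else Q (r - 1) - Q r)‖ := by
  rw [Matrix.mul_assoc]
  calc _ ≤ ‖(if p = 0 then 1 - Q 0 else Q (p - 1) - Q p)‖ *
        ‖Y * (if r = 0 then 1 - Q 0 else Q (r - 1) - Q r)‖ := norm_mul_le _ _
    _ ≤ 1 * ‖Y * (if r = 0 then 1 - Q 0 else Q (r - 1) - Q r)‖ :=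
        mul_le_mul_of_nonneg_right (norm_shell_le_one hQ hQ' hQh p) (norm_nonneg _)
    _ = _ := one_mul _

/-- `‖E_p Y‖ ≤ ‖Q_{p-1} Y‖ + ‖Q_p Y‖` for `p ≥ 1`, and `≤ ‖Y‖ + ‖Q₀ Y‖` for `p = 0`. [folklore] -/
theorem norm_shell_mul_le (p : ℕ) (Y : Matrix n n ℂ) :
    ‖(if p = 0 then 1 - Q 0 else Q (p - 1) - Q p) * Y‖ ≤
      (if p = 0 then ‖Y‖ else ‖Q (p - 1) * Y‖) + ‖Q p * Y‖ := by
  by_cases hp : p = 0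
  · subst hp
    rw [if_pos rfl, if_pos rfl, Matrix.sub_mul, Matrix.one_mul]
    exact norm_sub_le _ _
  · rw [if_neg hp, if_neg hp, Matrix.sub_mul]
    exact norm_sub_le _ _

end Shells

end Literature.MathematicalPhysics.QuantumLattice
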